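import Summits.KontsevichZagierPeriods.KontsevichZagierPeriods.Theses.FurushoPentagon
import Summits.KontsevichZagierPeriods.KontsevichZagierPeriods.Theorems.FurushoPentagonSectorToKernelAdmissibleOfTameSeries
import Summits.KontsevichZagierPeriods.KontsevichZagierPeriods.Theorems.FurushoPentagonSectorToKernelAdmissibleOfTameAlgebraic
import Summits.KontsevichZagierPeriods.KontsevichZagierPeriods.Theorems.FurushoPentagonSectorToKernelAdmissibleOfTameSubdiv
import Literature.NumberTheory.Transcendental.KZCubicalCalculus
import Literature.NumberTheory.Transcendental.KZLogCalculusProofs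
import Literature.NumberTheory.Transcendental.SemialgebraicMapsProofs

/-!
# `SectorToKernel`, line `effective-cube-surjection`: tame ⇒ admissible (stub S2)

Stub `stub_admissibleOfTame` of the crux `FurushoPentagon.SectorToKernel`
(stmt-KontsevichZagierPeriods-10813). A TAME cube representation `r` (domain the closed unit cube
`[0,1]ⁿ`, integrand `f` real-analytic at every point of the closed cube and `ℚ`-semialgebraic on it) is
equivalent, INSIDE the Kontsevich–Zagier calculus of moves, to an Ayoub-ADMISSIBLE cube representation
`s`: the integrand of `s` is on the cube the sum of one real power series `F` with summable majorant of
polyradius `2 > 1`, and is algebraic over `ℚ[x]`.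

Proof. (1) By compactness of the cube, `f` has a power series expansion of a uniform radius `δ > 0`
around every point of the cube (`admOfTame_exists_uniform_radius`). (2) For `N = 2ʲ` with `N δ > 2n`
the average `g(x) = ∑_{k ∈ {0,…,N-1}ⁿ} N⁻ⁿ f((k + x)/N)` is tame and `[r] ∼ [[0,1]ⁿ, g]` by `j` rounds
of dyadic subdivision along each coordinate and re-summing (`admOfTame_rel_avg`,
`KZ.cubicalSubdivGens_subset_relations`, `KZ.cubicalLinGens_subset_relations`). (3) Each summand of `g`
is `f` re-expanded around the cube point `k/N` and rescaled by `N`, so `g` has a power series at `0`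
of sup-radius `N δ > 2n` (`admOfTame_hasFPowerSeriesOnBall_rescale`), which regroups into one
multivariable power series with `∑ |Fₐ| 2^{|a|} < ∞` summing to `g` on the cube
(`admOfTame_exists_mvPowerSeries`). (4) `g` is `ℚ`-semialgebraic on the cube, hence annihilated there
by a non-zero `P ∈ ℚ[x][Y]` (`admOfTame_exists_polynomial_of_isSemialgebraicFunOn`).

References: J. Ayoub, *Periods and the conjectures of Grothendieck and Kontsevich–Zagier*, EMS
Newsletter 91 (2014), Def. 9 and Rem. 12; J. Ayoub, *Une version relative de la conjecture des
périodes de Kontsevich–Zagier*, Ann. of Math. 181 (2015), Conj. 1.1; M. Kontsevich, D. Zagier,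
*Periods* (2001), §1.2; S. G. Krantz, H. R. Parks, *A Primer of Real Analytic Functions* (2002), §2.2.
-/

noncomputable section

namespace Summit.KontsevichZagierPeriods.FurushoPentagon.SectorToKernel

open Set MeasureTheory
open Literature.NumberTheory.Transcendental
open Literature.NumberTheory.Transcendental.KZ hiding cubicalSpan
open Summit.KontsevichZagierPeriods.KontsevichZagierPeriods.Theses.FurushoPentagon
open scoped NNReal ENNReal

/-- The lattice points `k/N`, `k ∈ {0, …, N-1}ⁿ`, lie in the closed unit cube. [folklore] -/
theorem admOfTame_latticePoint_mem_cube {n N : ℕ} (k : Fin n → Fin N) :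
    (fun j => (((k j : Fin N) : ℕ) : ℝ) / N) ∈ KZ.cube n := by
  intro j
  have hN : (0 : ℝ) < N := by exact_mod_cast (k j).pos
  have hk : (((k j : Fin N) : ℕ) : ℝ) + 1 ≤ N := by exact_mod_cast (k j).2
  refine ⟨div_nonneg (Nat.cast_nonneg _) hN.le, ?_⟩
  rw [div_le_one hN]
  linarith

/-- **The average has a power series at `0` of sup-radius `N δ`.** If `f` has a power series expansion
of radius `δ` around every point of the cube, then `x ↦ ∑_{k} N⁻ⁿ f((k + x)/N)` has one at `0` of
radius `N δ` (each summand is `f` re-expanded around `k/N ∈ [0,1]ⁿ` and rescaled by `N`).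
[Krantz–Parks 2002, §2.2; folklore] -/
theorem admOfTame_hasFPowerSeriesOnBall_avg {n : ℕ} {f : (Fin n → ℝ) → ℝ} {δ : ℝ≥0} (hδ : 0 < δ)
    (hf : ∀ x ∈ KZ.cube n, ∃ q : FormalMultilinearSeries ℝ (Fin n → ℝ) ℝ,
      HasFPowerSeriesOnBall f q x δ)
    {N : ℕ} (hN : 0 < N) :
    ∃ p : FormalMultilinearSeries ℝ (Fin n → ℝ) ℝ,
      HasFPowerSeriesOnBall (fun x => ∑ k : Fin n → Fin N, ((N : ℝ) ^ n)⁻¹ *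
        f (fun j => ((((k j : Fin N) : ℕ) : ℝ) + x j) / N)) p 0
        (((N : ℝ≥0) * δ : ℝ≥0) : ℝ≥0∞) := by
  classical
  choose q hq using fun k : Fin n → Fin N => hf _ (admOfTame_latticePoint_mem_cube k)
  have hr : (0 : ℝ≥0∞) < (((N : ℝ≥0) * δ : ℝ≥0) : ℝ≥0∞) := by
    exact_mod_cast mul_pos (by exact_mod_cast hN) hδ
  have key : ∀ k : Fin n → Fin N,
      HasFPowerSeriesOnBall (fun x => ((N : ℝ) ^ n)⁻¹ *
          f (fun j => ((((k j : Fin N) : ℕ) : ℝ) + x j) / N))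
        (((N : ℝ) ^ n)⁻¹ • (q k).compContinuousLinearMap
          ((N : ℝ)⁻¹ • ContinuousLinearMap.id ℝ (Fin n → ℝ))) 0
        (((N : ℝ≥0) * δ : ℝ≥0) : ℝ≥0∞) := by
    intro k
    have h1 := (admOfTame_hasFPowerSeriesOnBall_rescale hδ (hq k) hN).const_smul
      (c := ((N : ℝ) ^ n)⁻¹)
    have hfun : (((N : ℝ) ^ n)⁻¹ • fun x : Fin n → ℝ =>
        f ((fun j => (((k j : Fin N) : ℕ) : ℝ) / N) + (N : ℝ)⁻¹ • x)) =
        fun x => ((N : ℝ) ^ n)⁻¹ * f (fun j => ((((k j : Fin N) : ℕ) : ℝ) + x j) / N) := by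
      funext x
      simp only [Pi.smul_apply, smul_eq_mul]
      congr 2
      funext j
      simp only [Pi.add_apply, Pi.smul_apply, smul_eq_mul]
      ring
    rw [hfun] at h1
    exact h1
  exact ⟨_, admOfTame_hasFPowerSeriesOnBall_sum Finset.univ hr fun k _ => key k⟩

/-- **S2 (tame ⇒ admissible).** A tame cube representation is equivalent, in the Kontsevich–Zagier
calculus, to an Ayoub-admissible one: integrand on the cube the sum of one real power series with
summable majorant of polyradius `2`, and algebraic over `ℚ[x]` (dyadic subdivision and re-summing;
uniform radius of convergence on the compact cube; a `ℚ`-semialgebraic function is algebraic over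
`ℚ[x]`). [Ayoub 2014, Def. 9 and Rem. 12; Kontsevich–Zagier 2001, §1.2] -/
theorem stub_admissibleOfTame :
    ∀ (n : ℕ) (r : IntegralRep n), r.domain = KZ.cube n → AnalyticOnNhd ℝ r.integrand (KZ.cube n) → ∃ s : IntegralRep n, s.domain = KZ.cube n ∧ (∃ (F : MvPowerSeries (Fin n) ℝ) (ρ : ℝ), 1 < ρ ∧ Summable (fun a : Fin n →₀ ℕ => |MvPowerSeries.coeff a F| * ρ ^ (a.sum fun _ e => e)) ∧ (∀ x ∈ KZ.cube n, HasSum (fun a : Fin n →₀ ℕ => MvPowerSeries.coeff a F * a.prod (fun j e => x j ^ e)) (s.integrand x)) ∧ ∃ P : Polynomial (MvPolynomial (Fin n) ℚ), P ≠ 0 ∧ ∀ x ∈ KZ.cube n, Polynomial.eval₂ (MvPolynomial.aeval x : MvPolynomial (Fin n) ℚ →ₐ[ℚ] ℝ).toRingHom (s.integrand x) P = 0) ∧ of r - of s ∈ relations := by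
  intro n r hrd hra
  have hf : AnalyticOnNhd ℝ r.integrand (KZ.cube n) ∧ IsSemialgebraicFunOn ℚ (KZ.cube n) r.integrand :=
    ⟨hra, hrd ▸ r.isSemialgebraicFunOn_integrand⟩
  -- (1) a uniform radius of convergence on the compact cube
  obtain ⟨δ, hδ, hfδ⟩ := admOfTame_exists_uniform_radius KZ.isCompact_cube hra
  -- (2) the subdivision depth `j`, `2ʲ δ > 2 n`
  obtain ⟨j, hj⟩ : ∃ j : ℕ, (n : ℝ≥0) * 2 / δ < 2 ^ j := pow_unbounded_of_one_lt _ one_lt_two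
  have hN : 0 < 2 ^ j := pow_pos two_pos j
  -- the averaged integrand and its tame cube class
  have hG := admOfTame_tame_avg (2 ^ j) hf
  refine ⟨IntegralRep.tameCube _ hG.1 hG.2, rfl, ?_, ?_⟩
  · -- (3)–(4) admissibility data
    obtain ⟨p, hp⟩ := admOfTame_hasFPowerSeriesOnBall_avg hδ hfδ hN
    have hR : (((n : ℝ≥0) * 2 : ℝ≥0) : ℝ≥0∞) < ((((2 ^ j : ℕ) : ℝ≥0) * δ : ℝ≥0) : ℝ≥0∞) := by
      rw [ENNReal.coe_lt_coe, Nat.cast_pow, Nat.cast_ofNat]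
      rwa [div_lt_iff₀ hδ] at hj
    obtain ⟨F, hFs, hFsum⟩ := admOfTame_exists_mvPowerSeries hp (ρ := 2) one_le_two hR
    refine ⟨F, 2, one_lt_two, by simpa using hFs, fun x hx => hFsum x (KZ.mem_cube.1 hx), ?_⟩
    exact admOfTame_exists_polynomial_of_isSemialgebraicFunOn hG.2
  · -- (2) the moves: `j` rounds of dyadic subdivision along each coordinate, re-summed
    have hr : of r = of (IntegralRep.tameCube r.integrand hf.1 hf.2) :=
      congrArg of (IntegralRep.ext' (r' := IntegralRep.tameCube r.integrand hf.1 hf.2) hrd rfl)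
    rw [hr]
    exact admOfTame_rel_avg j hf hG (fun x => rfl)

end Summit.KontsevichZagierPeriods.FurushoPentagon.SectorToKernel
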